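import Summits.QuantumFields.BalabanUV.Gaps.EndDrawdownEverySlope

/-!
# Gaps / EndDrawdownEverySlopeExact — GIVEN THE ONE-LOOP SIGNS, THE EVERY-SLOPE ROAD IS EXACT: for a one-loop sequence `b ≥ 0` (the FULL sign list
# — CAP and tail — of rows CAP ∕ tail, as a hypothesis on the Bałaban-free datum `b`), the END statement is FORCED over the every-slope realization
# class (`EndDrawdownEverySlope.EndForcedES b γc`) **IF AND ONLY IF** `∃ r > 0, DwSeq b r` (bounded drawdown below SOME line of positive slope — a
# positive lower DENSITY of the one-loop coefficients); in a drift class at slope `L` this is `0 < L` ON THE NOSE (boundary EXCLUDED: at `L = 0` E is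
# never forced), and at the β-lead's pinned literal, hypothesis-free, `0 < M∞`.  This CLOSES, for nonnegative one-loop parts, the first link of
# `EndDrawdownEverySlope.everySlope_chain` that §5 there left open.  The new half is an ADVERSARY: the realization `β_{k+1} = b_k − g_k` (the
# decaying-coupling remainder `betaN` of `EndDrawdownEverySlope` §4 on top of `b`) is on the every-slope road, and if its canonical construction has
# `EndpointExistence` then along each tuned run `1∕g_j² ≤ 1∕g⋆² + Σ_{[k,n)} b` for `j ∈ [k,n)` (backward, `b ≥ 0`) while `Σ_{[k,n)} g_j ≤ 1∕g⋆² + Σ_{[k,n)} b`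
# (forward), whence `(n − k) ≤ (1∕g⋆² + Σ_{[k,n)} b)^{3∕2}` for EVERY window — and a sequence `b ≥ 0` all of whose windows of length `m₀` carry mass
# `≥ 1` has `DwSeq b (1∕m₀)` (this seat's own leaf; cell pub-balaban-gaps, seat g1-p3 GEN 8, rows CAP ∕ tail «split ∕ weakening»; file 9 of
# «the one-loop interface of the END statement»)

HONEST FRAMING (cell rule, page 1 of everything): [folklore] one-step arithmetic of (0.20) for a TOY adversarial remainder on the tree's carriers
(`FlowStepRuns.modelOf` ∕ `genSeq`), plus a window-counting lemma on real sequences; `EndForcedES` is a quantified READING of the cell's END-grade statement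
over Bałaban-free data `(b, γc)`, not a binder.  The hypothesis `b ≥ 0` is the SHAPE of rows CAP ∕ tail's sign list (0 coefficients certified for
Bałaban's table; NODE-O instance 0∕1); `EverySlope` is row (D4)'s located UNPRINTED currency.  What the file says about rows CAP ∕ tail (words ∕ odds
UNCHANGED): even granted ALL one-loop signs, the END statement over the every-slope class needs — and needs exactly — a positive drawdown density of
`β⁰` (in a drift class: a STRICTLY positive slope); the signs alone (`b ≡ 0` has them) do not force it.  Nothing of Bałaban's is asserted; 0∕6 binders;
one finite T⁴; NOT [I] Thm 2, NOT `BetaPertH`, NOT the continuum limit, NOT Clay.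

CITATION HEADER (tags CONTEXT ONLY).  [I] = T. Bałaban, Commun. Math. Phys. **109** (1987) 249–301 [Balaban1987RG1]: (0.20) p. 256, Thm 2 p. 259 (first
sentence), (1.22) p. 264, Thm 3 p. 264, (2.12)–(2.14) p. 268.
-/

namespace Summit.QuantumFields.BalabanUV.Gaps.EndDrawdownEverySlopeExact

open Literature.MathematicalPhysics.QuantumFieldTheory.Balaban1983to89
open Literature.MathematicalPhysics.QuantumFieldTheory.Balaban1983to89.FlowStep
open Literature.MathematicalPhysics.QuantumFieldTheory.Balaban1983to89.FlowStepRuns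
open Literature.MathematicalPhysics.QuantumFieldTheory.Balaban1983to89.DagBinding
open Literature.MathematicalPhysics.QuantumFieldTheory.Balaban1983to89.Beta.Drift (OneLoopDrift)
open Literature.MathematicalPhysics.QuantumFieldTheory.Balaban1983to89.Beta.RateCertificate (CauchyRate)
open Literature.MathematicalPhysics.QuantumFieldTheory.Balaban1983to89.Beta.OneStepKernelFamily (TbalOf)
open Literature.MathematicalPhysics.QuantumFieldTheory.Balaban1983to89.Beta.AffineAveraging (box)
open Summit.QuantumFields.BalabanUV.Beta.MixedJetTablesPlug (JsBalAn1)
open Summit.QuantumFields.BalabanUV.Beta.GAN24.StencilSlotOfE3 (one_le_of_two_le)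
open Summit.QuantumFields.BalabanUV.Gaps.CapSignsConstRoad (EverySlope)
open Summit.QuantumFields.BalabanUV.Gaps.CapTailPinnedLimitSign (exists_geomRate_pinned)
open Summit.QuantumFields.BalabanUV.Gaps.EndDrawdownSeq
open Summit.QuantumFields.BalabanUV.Gaps.EndDrawdownBand
open Summit.QuantumFields.BalabanUV.Gaps.EndDrawdownEverySlope
open Finset

noncomputable section

/-! ## §1 The adversarial every-slope realization `β_{k+1} = b_k − g_k` of a one-loop sequence `b` -/

/-- The ADVERSARY: one-loop part `b`, remainder the decaying-coupling toy `betaN` (`−g_k` on `g_k > 0`, `0` otherwise). A TOY. [folklore] -/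
def betaAdv (b : ℕ → ℝ) : HBeta := fun k p => b k + betaN k p

/-- Its printed split: `β⁰ := b`, `β¹ := betaN`. [folklore] -/
def splitAdv (b : ℕ → ℝ) : B12Beta.OneLoopSplit (betaAdv b) where
  β0 := b
  β1 := betaN
  split := fun _ _ => rfl
  vanish := fun k p hp => by simp [betaN, hp]

/-- On a history with positive last coupling: `β_{k+1} = b_k − g_k`. [folklore] -/
theorem betaAdv_of_pos (b : ℕ → ℝ) (k : ℕ) {p : Fin (k + 1) → ℝ} (hp : 0 < p (Fin.last k)) :
    betaAdv b k p = b k - p (Fin.last k) := by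
  simp only [betaAdv, betaN_of_pos k hp]
  ring

/-- The adversary is on the EVERY-SLOPE road on every box `]0,γc]`. [folklore] -/
theorem everySlope_splitAdv (b : ℕ → ℝ) {γc : ℝ} (hγc : 0 < γc) : EverySlope (splitAdv b) γc := by
  intro s hs
  refine ⟨min s γc, lt_min hs hγc, min_le_right _ _, fun k p hp => ?_⟩
  have h := hp (Fin.last k)
  show |betaN k p| ≤ s
  rw [betaN_of_pos k h.1, abs_neg, abs_of_pos h.1]
  exact h.2.trans (min_le_left _ _)

/-- (C) for the adversary on every box. [folklore] -/
theorem betaContH_betaAdv (b : ℕ → ℝ) (γ : ℝ) : BetaContH γ (betaAdv b) := fun k =>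
  continuousOn_const.add (betaContH_betaN γ k)

/-! ## §2 Along a tuned run of the adversary: the `3∕2`-power window inequality -/

/-- ONE RG STEP of `modelOf (betaAdv b)` inside an in-interval run: `1∕g_{j+1}² = 1∕g_j² − b_j + g_j`. [folklore] -/
theorem step_adv (b : ℕ → ℝ) {g0 γ : ℝ} {n : ℕ} (hI : (modelOf (betaAdv b) ⟨n, 0, g0⟩).flow.InInterval γ n) {j : ℕ} (hj : j < n) :
    1 / (genSeq (betaAdv b) g0 (j + 1)) ^ 2 = 1 / (genSeq (betaAdv b) g0 j) ^ 2 - b j + genSeq (betaAdv b) g0 j := by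
  have hgj : 0 < genSeq (betaAdv b) g0 j := (hI j hj.le).1
  have hgj1 : 0 < genSeq (betaAdv b) g0 (j + 1) := (hI (j + 1) hj).1
  have hβ : betaAdv b j (prefixOf (genSeq (betaAdv b) g0) j) = b j - genSeq (betaAdv b) g0 j := by
    rw [betaAdv_of_pos b j (by simpa using hgj)]
    simp
  rcases le_or_gt (1 / (genSeq (betaAdv b) g0 j) ^ 2 - betaAdv b j (prefixOf (genSeq (betaAdv b) g0) j)) 0 with hle | hgt
  · exfalso
    have h := solveCoupling_nonpos hle
    rw [genSeq_succ] at hgj1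
    linarith
  · rw [genSeq_succ, inv_sq_solveCoupling hgt, hβ]
    ring

/-- TELESCOPED: `1∕g_j² = 1∕g_0² + Σ_{i<j} (g_i − b_i)` for `j ≤ n` along the run. [folklore] -/
theorem tele_adv (b : ℕ → ℝ) {g0 γ : ℝ} {n : ℕ} (hI : (modelOf (betaAdv b) ⟨n, 0, g0⟩).flow.InInterval γ n) :
    ∀ j, j ≤ n → 1 / (genSeq (betaAdv b) g0 j) ^ 2 =
      1 / (genSeq (betaAdv b) g0 0) ^ 2 + ∑ i ∈ Finset.range j, (genSeq (betaAdv b) g0 i - b i) := by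
  intro j
  induction j with
  | zero => intro _; simp
  | succ j ih =>
    intro hj
    rw [Finset.sum_range_succ, ← add_assoc, ← ih (Nat.le_of_succ_le hj), step_adv b hI (Nat.lt_of_succ_le hj)]
    ring

/-- WINDOW IDENTITY: `Σ_{[k,n)} (g_i − b_i) = 1∕g_n² − 1∕g_k²` for `k ≤ n`. [folklore] -/
theorem window_adv (b : ℕ → ℝ) {g0 γ : ℝ} {n : ℕ} (hI : (modelOf (betaAdv b) ⟨n, 0, g0⟩).flow.InInterval γ n) {k : ℕ} (hk : k ≤ n) :
    ∑ i ∈ Finset.Ico k n, (genSeq (betaAdv b) g0 i - b i) =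
      1 / (genSeq (betaAdv b) g0 n) ^ 2 - 1 / (genSeq (betaAdv b) g0 k) ^ 2 := by
  have h := Finset.sum_range_add_sum_Ico (fun i => genSeq (betaAdv b) g0 i - b i) hk
  have hn := tele_adv b hI n le_rfl
  have hk' := tele_adv b hI k hk
  linarith

/-- **THE `3∕2`-POWER WINDOW INEQUALITY** · for `b ≥ 0`, along an in-interval run of the adversary of length `n` ending at `g_n = g⋆`: for every `k ≤ n`,
`n − k ≤ t³` with `t := √(1∕g⋆² + Σ_{[k,n)} b)` — backward `1∕g_j² ≤ t²` (so `t·g_j ≥ 1`) for `j ∈ [k,n)`, forward `Σ_{[k,n)} g_j ≤ t²`. [folklore] -/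
theorem window_pow_adv {b : ℕ → ℝ} (hb : ∀ j, 0 ≤ b j) {g0 γ gstar : ℝ} {n : ℕ}
    (hI : (modelOf (betaAdv b) ⟨n, 0, g0⟩).flow.InInterval γ n) (hend : genSeq (betaAdv b) g0 n = gstar) {k : ℕ} (hk : k ≤ n) :
    ((n : ℝ) - k) ≤ Real.sqrt (1 / gstar ^ 2 + ∑ i ∈ Finset.Ico k n, b i) ^ 3 := by
  set S : ℝ := ∑ i ∈ Finset.Ico k n, b i with hS
  have hS0 : 0 ≤ S := Finset.sum_nonneg fun i _ => hb i
  have hT0 : 0 ≤ 1 / gstar ^ 2 + S := by positivity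
  set t : ℝ := Real.sqrt (1 / gstar ^ 2 + S) with ht
  have ht0 : 0 ≤ t := Real.sqrt_nonneg _
  have htsq : t ^ 2 = 1 / gstar ^ 2 + S := Real.sq_sqrt hT0
  have hgpos : ∀ j, j ≤ n → 0 < genSeq (betaAdv b) g0 j := fun j hj => (hI j hj).1
  -- backward bound: for j ∈ [k,n): 1/g_j² ≤ 1/g⋆² + S
  have hback : ∀ j ∈ Finset.Ico k n, 1 / (genSeq (betaAdv b) g0 j) ^ 2 ≤ 1 / gstar ^ 2 + S := by
    intro j hj
    have hkj : k ≤ j := (Finset.mem_Ico.mp hj).1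
    have hjn : j ≤ n := (Finset.mem_Ico.mp hj).2.le
    have hw := window_adv b hI hjn
    rw [Finset.sum_sub_distrib, hend] at hw
    have hgsum : 0 ≤ ∑ i ∈ Finset.Ico j n, genSeq (betaAdv b) g0 i :=
      Finset.sum_nonneg fun i hi => (hgpos i (Finset.mem_Ico.mp hi).2.le).le
    have hbsub : ∑ i ∈ Finset.Ico j n, b i ≤ S :=
      Finset.sum_le_sum_of_subset_of_nonneg (Finset.Ico_subset_Ico_left hkj) fun i _ _ => hb i
    linarith
  -- hence t · g_j ≥ 1 on the window
  have htg : ∀ j ∈ Finset.Ico k n, (1 : ℝ) ≤ t * genSeq (betaAdv b) g0 j := by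
    intro j hj
    have hgj := hgpos j (Finset.mem_Ico.mp hj).2.le
    have h1 : 1 ≤ (1 / gstar ^ 2 + S) * (genSeq (betaAdv b) g0 j) ^ 2 := by
      have := hback j hj
      rwa [div_le_iff₀ (pow_pos hgj 2)] at this
    rw [← htsq] at h1
    nlinarith [mul_nonneg ht0 hgj.le, h1]
  -- forward bound: Σ_{[k,n)} g ≤ t²
  have hfwd : ∑ i ∈ Finset.Ico k n, genSeq (betaAdv b) g0 i ≤ t ^ 2 := by
    have hw := window_adv b hI hk
    rw [Finset.sum_sub_distrib, hend] at hw
    have hk0 : 0 < 1 / (genSeq (betaAdv b) g0 k) ^ 2 := one_div_pos.mpr (pow_pos (hgpos k hk) 2)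
    rw [htsq]
    linarith
  -- count: (n − k) ≤ t · Σ g ≤ t³
  have hcount : ((n : ℝ) - k) ≤ t * ∑ i ∈ Finset.Ico k n, genSeq (betaAdv b) g0 i := by
    rw [Finset.mul_sum]
    have h := Finset.sum_le_sum htg
    rw [Finset.sum_const, Nat.card_Ico, nsmul_eq_mul, mul_one, Nat.cast_sub hk] at h
    exact h
  calc ((n : ℝ) - k) ≤ t * ∑ i ∈ Finset.Ico k n, genSeq (betaAdv b) g0 i := hcount
    _ ≤ t * t ^ 2 := mul_le_mul_of_nonneg_left hfwd ht0
    _ = t ^ 3 := by ring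

/-! ## §3 A window-counting lemma: `3∕2`-power growth of all windows of a nonnegative sequence gives a positive drawdown threshold -/

/-- If `b ≥ 0` and EVERY window satisfies `n − k ≤ √(C + Σ_{[k,n)} b)³` (`C ≥ 0`), then every window of length `m₀ := ⌈√(C+1)³⌉₊ + 1` carries mass `≥ 1`,
hence `DwSeq b (1∕m₀)`: a POSITIVE drawdown threshold. [folklore] -/
theorem dwSeq_pos_of_windowGrowth {b : ℕ → ℝ} (hb : ∀ j, 0 ≤ b j) {C : ℝ} (hC : 0 ≤ C)
    (h : ∀ k n : ℕ, k ≤ n → ((n : ℝ) - k) ≤ Real.sqrt (C + ∑ j ∈ Finset.Ico k n, b j) ^ 3) :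
    ∃ r : ℝ, 0 < r ∧ DwSeq b r := by
  set m₀ : ℕ := ⌈Real.sqrt (C + 1) ^ 3⌉₊ + 1 with hm₀
  have hm₀pos : 0 < m₀ := Nat.succ_pos _
  have hm₀R : Real.sqrt (C + 1) ^ 3 < (m₀ : ℝ) := by
    rw [hm₀]; push_cast
    exact (Nat.le_ceil _).trans_lt (lt_add_one _)
  -- every window of length m₀ carries mass ≥ 1
  have hblock : ∀ k : ℕ, 1 ≤ ∑ j ∈ Finset.Ico k (k + m₀), b j := by
    intro k
    refine le_of_not_gt fun hlt => ?_
    have hS0 : 0 ≤ ∑ j ∈ Finset.Ico k (k + m₀), b j := Finset.sum_nonneg fun j _ => hb j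
    have hw := h k (k + m₀) (Nat.le_add_right _ _)
    have hL : ((k + m₀ : ℕ) : ℝ) - k = m₀ := by push_cast; ring
    rw [hL] at hw
    have hsqrt : Real.sqrt (C + ∑ j ∈ Finset.Ico k (k + m₀), b j) < Real.sqrt (C + 1) :=
      Real.sqrt_lt_sqrt (by linarith) (by linarith)
    have hpow : Real.sqrt (C + ∑ j ∈ Finset.Ico k (k + m₀), b j) ^ 3 < Real.sqrt (C + 1) ^ 3 :=
      pow_lt_pow_left₀ hsqrt (Real.sqrt_nonneg _) three_ne_zero
    linarith
  -- q consecutive blocks carry mass ≥ q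
  have hblocks : ∀ q k : ℕ, (q : ℝ) ≤ ∑ j ∈ Finset.Ico k (k + q * m₀), b j := by
    intro q
    induction q with
    | zero => intro k; simp
    | succ q ih =>
      intro k
      have h2 : k + (q + 1) * m₀ = (k + q * m₀) + m₀ := by ring
      have hsplit := Finset.sum_Ico_consecutive b (Nat.le_add_right k (q * m₀))
        (by rw [h2]; exact Nat.le_add_right _ _ : k + q * m₀ ≤ k + (q + 1) * m₀)
      rw [← hsplit, h2]
      push_cast
      linarith [ih k, hblock (k + q * m₀)]
  refine ⟨1 / m₀, by positivity, 1, fun k n hkn => ?_⟩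
  obtain ⟨L, rfl⟩ := Nat.exists_eq_add_of_le hkn
  have hqle : L / m₀ * m₀ ≤ L := Nat.div_mul_le_self L m₀
  have hdm := Nat.div_add_mod L m₀
  have hml := Nat.mod_lt L hm₀pos
  have hLlt : L < (L / m₀ + 1) * m₀ := by
    have h3 : (L / m₀ + 1) * m₀ = m₀ * (L / m₀) + m₀ := by ring
    rw [h3]; omega
  have hsub : ∑ j ∈ Finset.Ico k (k + L / m₀ * m₀), b j ≤ ∑ j ∈ Finset.Ico k (k + L), b j :=
    Finset.sum_le_sum_of_subset_of_nonneg (Finset.Ico_subset_Ico_right (by omega)) fun j _ _ => hb j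
  have hmain := (hblocks (L / m₀) k).trans hsub
  rw [sum_Ico_sub_const b (1 / m₀) hkn]
  have hm₀R0 : (0 : ℝ) < m₀ := by exact_mod_cast hm₀pos
  have hLq : ((k + L : ℕ) : ℝ) - k = L := by push_cast; ring
  rw [hLq]
  have hLlt' : (L : ℝ) < ((L / m₀ : ℕ) + 1 : ℝ) * m₀ := by exact_mod_cast hLlt
  have hdiv : 1 / (m₀ : ℝ) * L ≤ (L / m₀ : ℕ) + 1 := by
    rw [one_div_mul_eq_div, div_le_iff₀ hm₀R0]
    exact hLlt'.le
  linarith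

/-! ## §4 EXACTNESS on the every-slope road for nonnegative one-loop parts -/

/-- **THE ADVERSARY KILLS THE END WITHOUT A POSITIVE DRAWDOWN THRESHOLD** · `b ≥ 0` and `EndpointExistence (modelOf (betaAdv b))` ⟹ `∃ r > 0, DwSeq b r`.
[folklore] -/
theorem dwSeq_pos_of_endpointExistence_adv {b : ℕ → ℝ} (hb : ∀ j, 0 ≤ b j) (hE : EndpointExistence (modelOf (betaAdv b))) :
    ∃ r : ℝ, 0 < r ∧ DwSeq b r := by
  obtain ⟨γ₂, hγ₂, h⟩ := hE 0
  obtain ⟨gstar, hgstar, h⟩ := h γ₂ hγ₂ le_rfl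
  have hrun := h gstar hgstar le_rfl
  refine dwSeq_pos_of_windowGrowth hb (C := 1 / gstar ^ 2) (by positivity) fun k n hkn => ?_
  obtain ⟨g0, hI, hend⟩ := hrun n
  exact window_pow_adv hb hI hend hkn

/-- **EXACTNESS, GIVEN THE SIGNS** · for a NONNEGATIVE one-loop sequence `b` (the full sign list of rows CAP ∕ tail as a hypothesis) and `0 < γc`:
E is FORCED over the every-slope realization class **iff** `∃ r > 0, DwSeq b r` — the first link of `EndDrawdownEverySlope.everySlope_chain` is an
EQUIVALENCE for `b ≥ 0`.  The signs alone do not force E (`b ≡ 0`). [cite: Balaban1987RG1, Thm 2 p.259 (first sentence) and Thm 3 p.264] -/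
theorem endForcedES_iff_dwSeq_pos_of_nonneg {b : ℕ → ℝ} (hb : ∀ j, 0 ≤ b j) {γc : ℝ} (hγc : 0 < γc) :
    EndForcedES b γc ↔ ∃ r : ℝ, 0 < r ∧ DwSeq b r :=
  ⟨fun h => dwSeq_pos_of_endpointExistence_adv hb
      (h _ (splitAdv b) _ (fun _ => rfl) (everySlope_splitAdv b hγc) (betaContH_betaAdv b γc) (modelOf_forwardGenerated _)),
    fun ⟨_, hr, hDw⟩ => endForcedES_of_dwSeq_pos hr hDw⟩

/-- GIVEN THE SIGNS, E IS ALWAYS POSSIBLE over the every-slope class (`b ≥ 0 ⟹ DwSeq b 0 ⟹` the zero-remainder realization has E): for nonnegative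
one-loop parts the every-slope picture is complete — POSSIBLE always, FORCED ⟺ `∃ r > 0, DwSeq b r`. [cite: Balaban1987RG1, Thm 2 p.259 (first sentence)] -/
theorem endPossibleES_of_nonneg {b : ℕ → ℝ} (hb : ∀ j, 0 ≤ b j) {γc : ℝ} (hγc : 0 < γc) : EndPossibleES b γc :=
  endPossibleES_of_dwSeq_zero hγc (dwSeq_of_forall_le hb)

/-- **IN A DRIFT CLASS, GIVEN THE SIGNS: FORCED ⟺ `0 < L` ON THE NOSE** (boundary EXCLUDED) — with `EndDrawdownEverySlope.endPossibleES_iff_of_oneLoopDrift`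
(POSSIBLE ⟺ `0 ≤ L`) the every-slope band for nonnegative drift-class one-loop parts is EXACTLY the boundary `L = 0`.
[cite: Balaban1987RG1, Thm 2 p.259 (first sentence) and (1.22) p.264] -/
theorem endForcedES_iff_pos_of_oneLoopDrift {b : ℕ → ℝ} (hb : ∀ j, 0 ≤ b j) {γc L A : ℝ} (hγc : 0 < γc)
    (hA : OneLoopDrift L A b) : EndForcedES b γc ↔ 0 < L := by
  rw [endForcedES_iff_dwSeq_pos_of_nonneg hb hγc]
  constructor
  · rintro ⟨r, hr, hDw⟩
    exact hr.trans_le ((dwSeq_iff_of_oneLoopDrift hA r).mp hDw)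
  · exact fun hL => ⟨L, hL, dwSeq_of_oneLoopDrift hA le_rfl⟩

/-- THE BAND IS THE BOUNDARY · nonnegative drift-class one-loop part: E possible-and-not-forced over the every-slope class ⟺ `L = 0`.
[cite: Balaban1987RG1, Thm 2 p.259 (first sentence) and (1.22) p.264] -/
theorem band_iff_slope_zero_of_oneLoopDrift {b : ℕ → ℝ} (hb : ∀ j, 0 ≤ b j) {γc L A : ℝ} (hγc : 0 < γc)
    (hA : OneLoopDrift L A b) : (EndPossibleES b γc ∧ ¬ EndForcedES b γc) ↔ L = 0 := by
  rw [endPossibleES_iff_of_oneLoopDrift hγc hA, endForcedES_iff_pos_of_oneLoopDrift hb hγc hA, not_lt]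
  constructor
  · rintro ⟨h1, h2⟩; exact le_antisymm h2 h1
  · intro h; exact ⟨h.symm.le, h.le⟩

/-- **AT THE β-LEAD's PINNED LITERAL, GIVEN THE SIGNS** (hypothesis-free rate; the sign list `0 ≤ β⁰_table j` of the literal is a HYPOTHESIS — 0 coefficients
certified): over ALL T0-pinned splits on the every-slope road with (C), E is FORCED ⟺ `0 < M∞`.  Sharpens `EndDrawdownEverySlope.everySlope_pinned_sign`
(`0 < M∞ ⟹ FORCED ⟹ 0 ≤ M∞`) to a decision at the boundary. [cite: Balaban1987RG1, Thm 2 p.259 (first sentence) and (1.22) p.264] -/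
theorem endForcedES_pinned_iff_of_signs {Lc : ℕ} [NeZero Lc] (hLc : 2 ≤ Lc) {r : Fin (3 + 1) → ℕ} (hr : r ∈ box (3 + 1) Lc) (cE cVH cΛ cB : ℝ)
    (Tc : Fin 4 → Fin 4 → Fin 4 → Fin 4 → ℝ) (μ ν : Fin 4) {γc : ℝ} (hγc : 0 < γc)
    (hsign : ∀ j, 0 ≤ B12Beta.secondMoment (TbalOf Lc (JsBalAn1 (one_le_of_two_le hLc) hr cE cVH cΛ ((Lc : ℝ) ^ (2 * (3 + 1))) cB Tc) j) μ ν) :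
    EndForcedES (fun j => B12Beta.secondMoment
        (TbalOf Lc (JsBalAn1 (one_le_of_two_le hLc) hr cE cVH cΛ ((Lc : ℝ) ^ (2 * (3 + 1))) cB Tc) j) μ ν) γc ↔
      0 < CauchyRate.lim fun j =>
        B12Beta.secondMoment (TbalOf Lc (JsBalAn1 (one_le_of_two_le hLc) hr cE cVH cΛ ((Lc : ℝ) ^ (2 * (3 + 1))) cB Tc) j) μ ν := by
  obtain ⟨c₀, θ, hθ0, hθ1, hG⟩ := exists_geomRate_pinned hLc hr cE cVH cΛ cB Tc μ ν
  exact endForcedES_iff_pos_of_oneLoopDrift hsign hγc (hG.drift hθ0 hθ1)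

end

end Summit.QuantumFields.BalabanUV.Gaps.EndDrawdownEverySlopeExact
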